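import Mathlib.Topology.Algebra.MvPolynomial
import Mathlib.Analysis.Complex.Basic
import Literature.Computability.AlgebraicComplexity.AsymptoticSpectrum
import HarnessLib

/-!
# Sublevel sets of the asymptotic tensor rank are Zariski-closed (Christandl–Hoeberechts–Nieuwboer–Vrana–Zuiddam)

Cite item `wi-15069` (wanted by route `MatrixMultiplication/HesseHammingShells` — hypothesis of the
layer-2 glue `TriangleIsGeneric ∧ X_B → HesseLineARC → ShellUniformity` —, by route `HessianPlane`
and by the card `hesse-pencil-j-line-semicontinuity`).

Christandl–Hoeberechts–Nieuwboer–Vrana–Zuiddam, *Asymptotic tensor rank is characterized by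
polynomials* (STOC 2025; arXiv:2411.15789), **Theorem 1.2** (read, arXiv p. 4): "For any field `𝔽`,
`k ≥ 3`, `d ∈ ℤ^k_{≥1}`, and `r ∈ ℝ`, the sublevel set
`{T ∈ 𝔽^{d₁} ⊗ ⋯ ⊗ 𝔽^{d_k} : R̃(T) ≤ r}` is Zariski-closed", where (§2.2, p. 7) the Zariski closure
of `A ⊆ V` is `Ā = {T ∈ V : ∀ f ∈ 𝔽[V], f|_A ≡ 0 ⇒ f(T) = 0}` and `A` is Zariski-closed iff
`A = Ā`.

* `chnvz_zariskiClosed_asymptoticRank_le` — the named fact, for `k = 3` (the order of the tree's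
  tensors `ι → κ → μ → 𝔽` and of `Literature.Computability.AlgebraicComplexity.asymptoticRank`),
  rendered literally with the paper's definition of Zariski closure: if every polynomial in the
  entries that vanishes on `{S : R̃(S) ≤ r}` vanishes at `T`, then `R̃(T) ≤ r`. Polynomial FUNCTIONS
  `f ∈ 𝔽[V]` are the evaluations of `MvPolynomial (ι × κ × μ) 𝔽`, so this is the printed notion
  over every field (also finite ones).
* `chnvz_zariskiClosed_asymptoticRank_le.isClosed` — **proved corollary** (the paper's "It follows
  that the sublevel sets are also Euclidean-closed", §1, p. 4): over any Hausdorff topological field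
  — in particular `ℂ` (`isClosed_complex`) — the sublevel set `{t : ι → κ → μ → 𝔽 | R̃(t) ≤ r}` is
  closed in the product (Euclidean) topology; this is the shape the routes take as hypothesis.

## References

* M. Christandl, K. Hoeberechts, H. Nieuwboer, P. Vrana, J. Zuiddam, *Asymptotic tensor rank is
  characterized by polynomials*, Proc. 57th STOC (2025) 750–755 = arXiv:2411.15789, Thm 1.2 and
  §2.2 [ChristandlHoeberechtsNieuwboerVranaZuiddam2025].
-/

noncomputable section

namespace Literature.Computability.AlgebraicComplexity

open MvPolynomial

/-- The entries of a `3`-tensor `t : ι → κ → μ → K` as a point of `K^{ι × κ × μ}` (the coordinates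
on which polynomials in the entries are evaluated). [folklore] -/
def tensorEntries {K : Type*} {ι κ μ : Type*} (t : ι → κ → μ → K) : ι × κ × μ → K :=
  fun x => t x.1 x.2.1 x.2.2

/-- `tensorEntries` is continuous for the product topologies. [folklore] -/
theorem continuous_tensorEntries {K : Type*} [TopologicalSpace K] {ι κ μ : Type*} :
    Continuous (tensorEntries : (ι → κ → μ → K) → ι × κ × μ → K) :=
  continuous_pi fun x =>
    show Continuous fun t : ι → κ → μ → K => t x.1 x.2.1 x.2.2 by fun_prop

/-- **Christandl–Hoeberechts–Nieuwboer–Vrana–Zuiddam, Thm 1.2** (order `k = 3`): for every field `𝔽`,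
every format `ι × κ × μ` and every `r ∈ ℝ`, the sublevel set `{T : R̃(T) ≤ r}` of the asymptotic
rank is Zariski-closed, i.e. equals its Zariski closure in the printed sense (§2.2): whenever every
polynomial in the entries vanishing on `{S : R̃(S) ≤ r}` vanishes at `T`, already `R̃(T) ≤ r`.
[cite: ChristandlHoeberechtsNieuwboerVranaZuiddam2025, Theorem 1.2 (with the definition of Zariski closure of §2.2)] -/
def chnvz_zariskiClosed_asymptoticRank_le : Prop :=
  ∀ (F : Type) [Field F] (ι κ μ : Type) [Fintype ι] [Fintype κ] [Fintype μ] (r : ℝ)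
    (T : ι → κ → μ → F),
    (∀ p : MvPolynomial (ι × κ × μ) F,
      (∀ S : ι → κ → μ → F, asymptoticRank S ≤ r → eval (tensorEntries S) p = 0) →
        eval (tensorEntries T) p = 0) →
    asymptoticRank T ≤ r

/-- **Euclidean closedness of the sublevel sets** (the paper's remark after Thm 1.2: "It follows that
the sublevel sets are also Euclidean-closed, and that `R̃` is lower-semi-continuous"), PROVED from
the named fact: over a Hausdorff topological field `𝔽` the set `{t : ι → κ → μ → 𝔽 | R̃(t) ≤ r}` is
closed, being the intersection of the zero sets of the (continuous) polynomials vanishing on it.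
[cite: ChristandlHoeberechtsNieuwboerVranaZuiddam2025, §1.1 (remark after Theorem 1.2)] -/
theorem chnvz_zariskiClosed_asymptoticRank_le.isClosed (h : chnvz_zariskiClosed_asymptoticRank_le)
    {F : Type} [Field F] [TopologicalSpace F] [IsTopologicalRing F] [T1Space F]
    {ι κ μ : Type} [Fintype ι] [Fintype κ] [Fintype μ] (r : ℝ) :
    IsClosed {t : ι → κ → μ → F | asymptoticRank t ≤ r} := by
  -- the sublevel set is the intersection of the zero sets of the polynomials vanishing on it
  have key : {t : ι → κ → μ → F | asymptoticRank t ≤ r} =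
      ⋂ p ∈ {p : MvPolynomial (ι × κ × μ) F |
          ∀ S : ι → κ → μ → F, asymptoticRank S ≤ r → eval (tensorEntries S) p = 0},
        {t : ι → κ → μ → F | eval (tensorEntries t) p = 0} := by
    ext t
    simp only [Set.mem_setOf_eq, Set.mem_iInter]
    exact ⟨fun ht p hp => hp t ht, fun ht => h F ι κ μ r t fun p hp => ht p hp⟩
  rw [key]
  refine isClosed_biInter fun p _ => ?_
  exact isClosed_eq ((continuous_eval p).comp continuous_tensorEntries) continuous_const

/-- In particular over `ℂ`: for every format and every `r`, `{t : ι → κ → μ → ℂ | R̃(t) ≤ r}` is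
closed in the Euclidean topology — the hypothesis shape used by routes
`MatrixMultiplication/HesseHammingShells` and `HessianPlane`.
[cite: ChristandlHoeberechtsNieuwboerVranaZuiddam2025, §1.1 (remark after Theorem 1.2)] -/
theorem chnvz_zariskiClosed_asymptoticRank_le.isClosed_complex
    (h : chnvz_zariskiClosed_asymptoticRank_le) {ι κ μ : Type} [Fintype ι] [Fintype κ] [Fintype μ]
    (r : ℝ) : IsClosed {t : ι → κ → μ → ℂ | asymptoticRank t ≤ r} :=
  h.isClosed r

end Literature.Computability.AlgebraicComplexity

end
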